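/-
Copyright (c) 2026 the pub-hodgecm-mathlib formalisation cell (harness21).  Prover seat hodgecm-mathlib-K2Liu-p11 (g0), Track B «K2-LIT»,
#184♮ = hLiu418 = `stmt-HodgeConjecture-24832`; LEAD F0P6-plan (g12) DEAL 2026-09-04T07:52:11Z «(α) ADELIC→ARCH GLUE» + rider
07:54:09Z (the archSkew per-place brick), SIGS-RoadI-v3 §Hol.  THEOREMS ONLY (no `def`, no `instance`, no notation, no named-fact
hypothesis, no `sorry`).
-/
import Literature.NumberTheory.Automorphic.UnitaryGroupArchimedeanPlaces
import Literature.NumberTheory.Automorphic.UnitaryGroupArchSkew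
import Mathlib.Analysis.SpecialFunctions.Exponential
import Mathlib.Analysis.Calculus.Deriv.Mul
import HarnessLib

/-!
# Crux `HLiu418`, Road I: the archimedean Lie algebra `𝔲 = archSkew` PLACE BY PLACE, one-parameter subgroups under the place maps,
# and the topology of `U(J)(E ⊗ ℝ)` as a space of matrices

Cell `hodgecm-mathlib`, crux item hLiu418 = `stmt-HodgeConjecture-24832` (helper lane `--supports`, count-neutral).  Setting of
★ `UnitaryGroupArchimedean(Places)` ∕ ★ `UnitaryGroupArchSkew`: number fields `F ⊆ E`, `c : E ≃ₐ[F] E` with `c ≠ 1` fixing every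
infinite place (so `E` has no real place), `J ∈ M_N(E)`; `𝔲 = archSkew F E c N J ⊆ M_N(E ⊗ ℝ)`, `U(J)(E ⊗ ℝ) = arch F E c N J`,
`archLocal E N J w = U(σ_w J)(ℂ)`, `evalC E w : E ⊗ ℝ →+* ℂ` the `w`-coordinate.
* (B1) `mem_archSkew_iff_forall` — `X ∈ 𝔲` iff every `X_w := X.map (evalC E w)` satisfies `X_wᴴ (σ_w J) + (σ_w J) X_w = 0`
  (the Lie twin of ★ `mem_arch_iff_forall`);
* (B2) `eq_of_forall_map_evalC_eq`, `exists_archSkew_single` — matrices over `E ⊗ ℝ` are determined by their places, and a skew letter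
  at ONE place `w₀` extends by `0` to an element of `𝔲` (`X(w₀, Y₀)`); `map_evalC_add/smul` make `Y₀ ↦ X(w₀, Y₀)` linear;
* (B3) `map_evalC_exp` — `(exp X)_w = exp (X_w)` (★ `NormedSpace.map_exp` along the continuous ring hom `(evalC E w).mapMatrix`,
  `L∞`-operator norms opened INSIDE the proof), hence `coe_archAt_expGL_smul : (archAt w (expGL (tX)) : matrix) = exp (t X_w)`;
* (B4) `skew_of_forall_exp_mem` — if `exp (tY) ∈ U(σ_w J)(ℂ)` for all real `t` then `Yᴴ (σ_w J) + (σ_w J) Y = 0` (differentiate at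
  `t = 0`; ★ `hasDerivAt_exp_smul_const'`, product rule);
* (B5) `isInducing_coe_arch` — on `U(J′)` the inverse is the CONTINUOUS function `g ↦ J′⁻¹ (σ g)ᵀ J′` of the matrix of `g`, so the
  units topology of `U(J)(E ⊗ ℝ)` is induced by the matrix entries (★ `Units.isInducing_embedProduct`, `IsInducing.of_comp`) — the
  `hind` input of ★ `K2LiuHolDescendFrame.exists_holDescend_of_frame`.
References: [BorelJacquet1979, §4.1]; [Knapp2002, Introduction §2, I §1].
HONEST LABEL: HC_CM is proved only modulo the 7 printed citations (2 remaining named inputs: hLiu418 = stmt-HodgeConjecture-24832,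
h413 = stmt-HodgeConjecture-24833) until rung 0 closes; count-neutral helper, closes no socket.
-/

set_option autoImplicit false
set_option linter.dupNamespace false

noncomputable section

open scoped Classical Matrix Topology MatrixGroups
open NumberField NumberField.mixedEmbedding NumberField.InfinitePlace Filter Set NormedSpace
open Literature.NumberTheory.Automorphic Literature.NumberTheory.Automorphic.UnitaryGroup

namespace Summit.HodgeConjecture.HodgeConjecture.Cruxes.HLiu418.K2LiuArchSkewPlaces

variable (F E : Type) [Field F] [NumberField F] [Field E] [NumberField E] [Algebra F E] (c : E ≃ₐ[F] E) (N : ℕ)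
  (J : Matrix (Fin N) (Fin N) E) (hc : c ≠ 1) (hfix : ∀ w : InfinitePlace E, c • w = w)

/-! ## (B2₀) Matrices over `E ⊗ ℝ` place by place -/

omit [NumberField F] [NumberField E] in
include hc hfix in
/-- A matrix over `E ⊗ ℝ` is determined by its complex places. [folklore] -/
theorem eq_of_forall_map_evalC_eq {X X' : Matrix (Fin N) (Fin N) (mixedSpace E)}
    (h : ∀ w : {w : InfinitePlace E // IsComplex w}, X.map (evalC E w) = X'.map (evalC E w)) : X = X' := by
  refine Matrix.ext fun i j => mixedSpace_ext F E c hc hfix fun w => ?_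
  have hw := congrFun (congrFun (h w) i) j
  simpa only [Matrix.map_apply, evalC_apply] using hw

omit [NumberField F] [NumberField E] in
/-- The place maps are additive on matrices. [folklore] -/
theorem map_evalC_add (w : {w : InfinitePlace E // IsComplex w}) (X X' : Matrix (Fin N) (Fin N) (mixedSpace E)) :
    (X + X').map (evalC E w) = X.map (evalC E w) + X'.map (evalC E w) :=
  (evalC E w).mapMatrix.map_add X X'

omit [NumberField F] [NumberField E] in
/-- The place maps are `ℝ`-linear on matrices. [folklore] -/
theorem map_evalC_smul (w : {w : InfinitePlace E // IsComplex w}) (t : ℝ) (X : Matrix (Fin N) (Fin N) (mixedSpace E)) :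
    (t • X).map (evalC E w) = t • X.map (evalC E w) := by
  ext i j
  simp only [Matrix.map_apply, Matrix.smul_apply, evalC_apply, Prod.smul_snd, Pi.smul_apply]

omit [NumberField F] [NumberField E] in
/-- The place maps are multiplicative on matrices. [folklore] -/
theorem map_evalC_mul (w : {w : InfinitePlace E // IsComplex w}) (X X' : Matrix (Fin N) (Fin N) (mixedSpace E)) :
    (X * X').map (evalC E w) = X.map (evalC E w) * X'.map (evalC E w) :=
  Matrix.map_mul

/-! ## (B1) `𝔲` place by place -/

omit [NumberField F] [NumberField E] in
include hc in
/-- The place map of `(σX)ᵀ J′ + J′ X`. [folklore] -/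
theorem map_evalC_skew (w : {w : InfinitePlace E // IsComplex w}) (hw : c • w.1 = w.1) (X : Matrix (Fin N) (Fin N) (mixedSpace E)) :
    (archStar F E c N X * archFormOf E N J + archFormOf E N J * X).map (evalC E w) =
      ((X.map (evalC E w)).map (starRingEnd ℂ))ᵀ * J.map w.1.embedding + J.map w.1.embedding * X.map (evalC E w) := by
  rw [map_evalC_add, map_evalC_mul, map_evalC_mul, archFormOf_map_evalC, archStar_apply]
  congr 2
  ext i j
  simp only [Matrix.map_apply, Matrix.transpose_apply]
  exact evalC_conjMixed F E c hw hc _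

omit [NumberField F] [NumberField E] in
include hc hfix in
/-- **`𝔲` is checked place by place**: `X ∈ archSkew F E c N J` iff at every complex place `w` the coordinate matrix `X_w = X.map (evalC E w)`
satisfies `X_wᴴ (σ_w J) + (σ_w J) X_w = 0`. [cite: BorelJacquet1979, §4.1] -/
theorem mem_archSkew_iff_forall (X : Matrix (Fin N) (Fin N) (mixedSpace E)) :
    X ∈ archSkew F E c N J ↔ ∀ w : {w : InfinitePlace E // IsComplex w},
      ((X.map (evalC E w)).map (starRingEnd ℂ))ᵀ * J.map w.1.embedding + J.map w.1.embedding * X.map (evalC E w) = 0 := by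
  rw [mem_archSkew_iff]
  constructor
  · intro h w
    rw [← map_evalC_skew F E c N J hc w (hfix w.1), h]
    ext i j
    simp only [Matrix.map_apply, Matrix.zero_apply, map_zero]
  · intro h
    refine eq_of_forall_map_evalC_eq F E c N hc hfix fun w => ?_
    rw [map_evalC_skew F E c N J hc w (hfix w.1), h w]
    ext i j
    simp only [Matrix.map_apply, Matrix.zero_apply, map_zero]

/-! ## (B2) A skew letter at one place extends by zero to an element of `𝔲` -/

omit [NumberField F] [NumberField E] in
include hc hfix in
/-- **Single-place letters of `𝔲`**: a matrix `Y₀` with `Y₀ᴴ (σ_{w₀} J) + (σ_{w₀} J) Y₀ = 0` is the `w₀`-coordinate of an element of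
`𝔲 = archSkew` whose other coordinates vanish. [cite: BorelJacquet1979, §4.1] -/
theorem exists_archSkew_single (w₀ : {w : InfinitePlace E // IsComplex w}) (Y₀ : Matrix (Fin N) (Fin N) ℂ)
    (hY₀ : (Y₀.map (starRingEnd ℂ))ᵀ * J.map w₀.1.embedding + J.map w₀.1.embedding * Y₀ = 0) :
    ∃ X : Matrix (Fin N) (Fin N) (mixedSpace E), X ∈ archSkew F E c N J ∧ X.map (evalC E w₀) = Y₀ ∧
      ∀ w : {w : InfinitePlace E // IsComplex w}, w ≠ w₀ → X.map (evalC E w) = 0 := by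
  set X : Matrix (Fin N) (Fin N) (mixedSpace E) := Matrix.of fun i j => ((0 : {w : InfinitePlace E // IsReal w} → ℝ),
    Pi.single w₀ (Y₀ i j)) with hX
  have hXw : ∀ w : {w : InfinitePlace E // IsComplex w}, X.map (evalC E w) = if w = w₀ then Y₀ else 0 := by
    intro w
    ext i j
    simp only [hX, Matrix.map_apply, Matrix.of_apply, evalC_apply]
    by_cases hw : w = w₀
    · subst hw; simp
    · rw [if_neg hw, Pi.single_eq_of_ne hw]; rfl
  refine ⟨X, ?_, ?_, fun w hw => ?_⟩
  · rw [mem_archSkew_iff_forall F E c N J hc hfix]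
    intro w
    rw [hXw]
    by_cases hw : w = w₀
    · subst hw; rw [if_pos rfl]; exact hY₀
    · rw [if_neg hw]; simp
  · rw [hXw, if_pos rfl]
  · rw [hXw, if_neg hw]

/-! ## (B3) One-parameter subgroups under the place maps -/

set_option backward.isDefEq.respectTransparency false in
omit [NumberField F] in
/-- **`(exp X)_w = exp (X_w)`** — the place map commutes with the matrix exponential. [cite: Knapp2002, Introduction §2] -/
theorem map_evalC_exp (w : {w : InfinitePlace E // IsComplex w}) (X : Matrix (Fin N) (Fin N) (mixedSpace E)) :
    (exp X).map (evalC E w) = exp (X.map (evalC E w)) :=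
  open scoped Matrix.Norms.Operator in
  NormedSpace.map_exp (evalC E w).mapMatrix (continuous_id.matrix_map (continuous_evalC E w)) X

omit [NumberField F] in
/-- The `w`-component of the one-parameter subgroup `expGL (tX)` of `U(J)(E ⊗ ℝ)` is `exp (t X_w)`. [cite: BorelJacquet1979, §4.1] -/
theorem coe_archAt_expGL_smul (w : {w : InfinitePlace E // IsComplex w}) (hw : c • w.1 = w.1)
    {X : Matrix (Fin N) (Fin N) (mixedSpace E)} (hX : X ∈ archSkew F E c N J) (t : ℝ) :
    (((archAt F E c N J w hw hc ⟨expGL (t • X), expGL_smul_mem_arch J hX t⟩ : archLocal E N J w) : GL (Fin N) ℂ) :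
        Matrix (Fin N) (Fin N) ℂ) = exp (t • X.map (evalC E w)) := by
  rw [coe_archAt]
  change ((expGL (t • X) : GL (Fin N) (mixedSpace E)) : Matrix (Fin N) (Fin N) (mixedSpace E)).map (evalC E w) = _
  rw [coe_expGL, map_evalC_exp, map_evalC_smul]

/-! ## (B4) From the one-parameter group to the Lie algebra -/

set_option backward.isDefEq.respectTransparency false in
/-- **Tangent of the unitary relation**: if `exp (tY)` preserves a form `H` for all real `t` (`(exp tY)ᴴ H (exp tY) = H`), then
`Yᴴ H + H Y = 0` (derivative at `t = 0`). [cite: Knapp2002, I §1] -/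
theorem skew_of_forall_exp_conjTranspose_mul {m : Type*} [Fintype m] [DecidableEq m] (H Y : Matrix m m ℂ)
    (h : ∀ t : ℝ, (exp (t • Y))ᴴ * H * exp (t • Y) = H) : Yᴴ * H + H * Y = 0 := by
  open scoped Matrix.Norms.Operator in
  -- `M ↦ Mᴴ` as a real-linear continuous map
  set C : Matrix m m ℂ →L[ℝ] Matrix m m ℂ := LinearMap.toContinuousLinearMap
    { toFun := fun M => Mᴴ
      map_add' := fun M M' => Matrix.conjTranspose_add M M'
      map_smul' := fun a M => by rw [Matrix.conjTranspose_smul, star_trivial, RingHom.id_apply] } with hC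
  have hCapp : ∀ M : Matrix m m ℂ, C M = Mᴴ := fun M => rfl
  have he : HasDerivAt (fun t : ℝ => exp (t • Y)) Y 0 := by
    have h' := hasDerivAt_exp_smul_const' (𝕂 := ℝ) Y 0
    rwa [zero_smul, NormedSpace.exp_zero, mul_one] at h'
  have he0 : exp ((0 : ℝ) • Y) = 1 := by rw [zero_smul, NormedSpace.exp_zero]
  have hct : HasDerivAt (fun t : ℝ => (exp (t • Y))ᴴ) Yᴴ 0 := by
    have h' := C.hasFDerivAt.comp_hasDerivAt 0 he
    rw [hCapp] at h'
    exact h'.congr_of_eventuallyEq (Eventually.of_forall fun t => (hCapp _).symm)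
  have hφ : HasDerivAt (fun t : ℝ => (exp (t • Y))ᴴ * H * exp (t • Y)) (Yᴴ * H * 1 + 1ᴴ * H * Y) 0 := by
    have h1 := (hct.mul_const H).mul he
    rw [he0] at h1
    refine h1.congr_deriv ?_
    rw [Matrix.conjTranspose_one]
  have hconst : HasDerivAt (fun t : ℝ => (exp (t • Y))ᴴ * H * exp (t • Y)) 0 0 := by
    have hfun : (fun t : ℝ => (exp (t • Y))ᴴ * H * exp (t • Y)) = fun _ => H := funext h
    rw [hfun]
    exact hasDerivAt_const 0 H
  have huniq := hφ.unique hconst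
  rw [Matrix.mul_one, Matrix.conjTranspose_one, Matrix.one_mul] at huniq
  exact huniq

omit [NumberField F] [NumberField E] in
/-- **From the group to `𝔲_w`**: if `exp (tY) ∈ U(σ_w J)(ℂ)` for every real `t`, then `Yᴴ (σ_w J) + (σ_w J) Y = 0`.
[cite: Knapp2002, I §1] -/
theorem skew_of_forall_exp_mem (w : {w : InfinitePlace E // IsComplex w}) (Y : Matrix (Fin N) (Fin N) ℂ)
    (h : ∀ t : ℝ, expGL (t • Y) ∈ archLocal E N J w) :
    (Y.map (starRingEnd ℂ))ᵀ * J.map w.1.embedding + J.map w.1.embedding * Y = 0 := by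
  have h' : ∀ t : ℝ, (exp (t • Y))ᴴ * J.map w.1.embedding * exp (t • Y) = J.map w.1.embedding := by
    intro t
    have ht := (mem_archLocal_iff E N J w _).1 (h t)
    rw [coe_expGL, ← Matrix.transpose_map] at ht
    exact ht
  have hs := skew_of_forall_exp_conjTranspose_mul _ _ h'
  rw [Matrix.conjTranspose, Matrix.transpose_map] at hs
  exact hs

/-! ## (B5) The units topology of `U(J)(E ⊗ ℝ)` is induced by the matrix entries -/

omit [NumberField F] [NumberField E] in
/-- On `U(J′)`, the inverse is `J′⁻¹ (σ g)ᵀ J′` (`J′` invertible). [cite: BorelJacquet1979, §4.1] -/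
theorem coe_inv_eq_of_mem_arch (hJ : IsUnit (archFormOf E N J).det) {g : GL (Fin N) (mixedSpace E)} (hg : g ∈ arch F E c N J) :
    ((g⁻¹ : GL (Fin N) (mixedSpace E)) : Matrix (Fin N) (Fin N) (mixedSpace E)) =
      (archFormOf E N J)⁻¹ * ((g : Matrix (Fin N) (Fin N) (mixedSpace E)).map (conjMixed F E c))ᵀ * archFormOf E N J := by
  have h := (mem_arch_iff F E c N J g).1 hg
  -- `(J′⁻¹ (σg)ᵀ J′) g = 1`
  have hleft : (archFormOf E N J)⁻¹ * ((g : Matrix (Fin N) (Fin N) (mixedSpace E)).map (conjMixed F E c))ᵀ * archFormOf E N J *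
      (g : Matrix (Fin N) (Fin N) (mixedSpace E)) = 1 := by
    rw [Matrix.mul_assoc, Matrix.mul_assoc, ← Matrix.mul_assoc ((g : Matrix (Fin N) (Fin N) (mixedSpace E)).map _)ᵀ, h,
      Matrix.nonsing_inv_mul _ hJ]
  have hg1 : ((g⁻¹ : GL (Fin N) (mixedSpace E)) : Matrix (Fin N) (Fin N) (mixedSpace E)) * (g : Matrix (Fin N) (Fin N) (mixedSpace E)) = 1 := by
    rw [← Units.val_mul, inv_mul_cancel, Units.val_one]
  -- uniqueness of the left inverse of the unit `g`
  have hu : IsUnit (g : Matrix (Fin N) (Fin N) (mixedSpace E)).det := (Matrix.isUnit_iff_isUnit_det _).1 (Units.isUnit g)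
  calc ((g⁻¹ : GL (Fin N) (mixedSpace E)) : Matrix (Fin N) (Fin N) (mixedSpace E))
      = ((g⁻¹ : GL (Fin N) (mixedSpace E)) : Matrix (Fin N) (Fin N) (mixedSpace E)) *
          ((g : Matrix (Fin N) (Fin N) (mixedSpace E)) * (g : Matrix (Fin N) (Fin N) (mixedSpace E))⁻¹) := by
        rw [Matrix.mul_nonsing_inv _ hu, Matrix.mul_one]
    _ = (g : Matrix (Fin N) (Fin N) (mixedSpace E))⁻¹ := by rw [← Matrix.mul_assoc, hg1, Matrix.one_mul]
    _ = (archFormOf E N J)⁻¹ * ((g : Matrix (Fin N) (Fin N) (mixedSpace E)).map (conjMixed F E c))ᵀ * archFormOf E N J *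
          ((g : Matrix (Fin N) (Fin N) (mixedSpace E)) * (g : Matrix (Fin N) (Fin N) (mixedSpace E))⁻¹) := by
        rw [← Matrix.mul_assoc, hleft, Matrix.one_mul]
    _ = _ := by rw [Matrix.mul_nonsing_inv _ hu, Matrix.mul_one]

omit [NumberField F] [NumberField E] in
/-- **The topology of `U(J)(E ⊗ ℝ)` is induced by the matrix entries** (`J′ = archFormOf E N J` invertible): the map
`U(J)(E ⊗ ℝ) → M_N(E ⊗ ℝ)`, `g ↦ g`, is inducing. [cite: BorelJacquet1979, §4.1] -/
theorem isInducing_coe_arch (hJ : IsUnit (archFormOf E N J).det) :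
    Topology.IsInducing (fun a : arch F E c N J => ((a : GL (Fin N) (mixedSpace E)) : Matrix (Fin N) (Fin N) (mixedSpace E))) := by
  -- `embedProduct ∘ val` is inducing
  have h1 : Topology.IsInducing (fun a : arch F E c N J => (a : GL (Fin N) (mixedSpace E))) := Topology.IsInducing.subtypeVal
  have h2 : Topology.IsInducing (Units.embedProduct (Matrix (Fin N) (Fin N) (mixedSpace E)) ∘
      fun a : arch F E c N J => (a : GL (Fin N) (mixedSpace E))) := Units.isInducing_embedProduct.comp h1
  -- it factors through the matrix map by a continuous map
  set Ψ : Matrix (Fin N) (Fin N) (mixedSpace E) → Matrix (Fin N) (Fin N) (mixedSpace E) × (Matrix (Fin N) (Fin N) (mixedSpace E))ᵐᵒᵖ :=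
    fun M => (M, MulOpposite.op ((archFormOf E N J)⁻¹ * (M.map (conjMixed F E c))ᵀ * archFormOf E N J)) with hΨ
  have hΨc : Continuous Ψ := by
    refine continuous_id.prodMk (MulOpposite.continuous_op.comp ?_)
    exact ((continuous_const.matrix_mul ((continuous_id.matrix_map (continuous_conjMixed F E c)).matrix_transpose)).matrix_mul
      continuous_const)
  have hfac : (Units.embedProduct (Matrix (Fin N) (Fin N) (mixedSpace E)) ∘ fun a : arch F E c N J => (a : GL (Fin N) (mixedSpace E))) =
      Ψ ∘ fun a : arch F E c N J => ((a : GL (Fin N) (mixedSpace E)) : Matrix (Fin N) (Fin N) (mixedSpace E)) := by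
    funext a
    simp only [Function.comp_apply, Units.embedProduct_apply, hΨ]
    rw [coe_inv_eq_of_mem_arch F E c N J hJ a.2]
  rw [hfac] at h2
  exact Topology.IsInducing.of_comp (Units.continuous_val.comp continuous_subtype_val) hΨc h2

end Summit.HodgeConjecture.HodgeConjecture.Cruxes.HLiu418.K2LiuArchSkewPlaces

end
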